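import Literature.Geometry.Riemannian.AlmostNonnegRicciFibration
import Literature.Geometry.Manifold.CircleSubmersionConnectedFibres
import HarnessLib

/-!
# Huang–Huang–Wang–Zhu 2026, Main Theorem 1 at `n = 4`, `b₁ = 1`: the connected-fibre clause is free

Reduction file for the named fact
`Literature.Geometry.Riemannian.huangHuangWangZhu2026_fibresOverCircle_four`
(`AlmostNonnegRicciFibration.lean`; H. Huang, X.-T. Huang, J. Wang, X. Zhu, *Fibrations, the First
Betti Number, and Almost Nonnegative Ricci Curvature*, arXiv:2605.24380 (2026), **Main Theorem 1**,
p. 3, proof §4, pp. 13–14). The fact concludes with a `C^∞` submersion `f : P → S¹` ALL OF WHOSE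
FIBRES ARE CONNECTED. In the paper the connectedness is the last paragraph of §4 (p. 14: the fibre
of `F : M → Tˢ/K` is connected because `F` lifts to a `1/4`-almost submetry onto a flat torus of
injectivity radius `≥ 1`). Here we record that, for the vendored statement, this clause costs
nothing: by the general theorem
`Literature.Geometry.Manifold.exists_contMDiff_surjective_mfderiv_isConnected_fibre`
(`Literature/Geometry/Manifold/CircleSubmersionConnectedFibres.lean`: Stein factorisation of a
circle-valued submersion of a closed manifold — monodromy-corrected `d`-th root, Ehresmann,
homotopy sequence) a compact connected manifold with SOME smooth submersion onto `S¹` has one with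
connected fibres, and `P ≃ₕ S¹ × S³` is (path) connected and nonempty.

* `pathConnectedSpace_of_homotopyEquiv` — a space homotopy equivalent to a path-connected space
  is path connected;
* `huangHuangWangZhu2026_fibresOverCircle_four_of_submersion` — **the named fact follows from
  its version WITHOUT the connected-fibre clause** (same hypotheses, conclusion: a `C^∞` submersion
  `P → S¹`).

So a discharge `huangHuangWangZhu2026_fibresOverCircle_four_holds` only has to produce a smooth
submersion `P → S¹` from the curvature hypotheses (the equivariant Gromov–Hausdorff / `RCD` part of
the printed proof, not available in the tree at present; see the STATUS paragraph of
`AlmostNonnegRicciFibrationProofs.lean`). No named fact is introduced here; everything is proved.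

## References

* H. Huang, X.-T. Huang, J. Wang, X. Zhu, arXiv:2605.24380 (2026), Main Theorem 1 (p. 3) and §4,
  pp. 13–14 (last paragraph: connectedness of the fibre). [HuangHuangWangZhu2026]
* A. Hatcher, *Algebraic Topology*, CUP (2002), Prop. 1.33, Thm. 4.41, Prop. 4.48. [HatcherAT2002]
-/

noncomputable section

open scoped Manifold ContDiff Topology
open Function Set

namespace Literature.Geometry.Riemannian

/-- **A space homotopy equivalent to a path-connected space is path connected**: every point
`x` is joined to `e⁻¹(e x)` along the homotopy `e⁻¹ ∘ e ≃ id`, and `e⁻¹` maps paths of `Y` to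
paths. [folklore] -/
theorem pathConnectedSpace_of_homotopyEquiv {X Y : Type*} [TopologicalSpace X] [TopologicalSpace Y]
    [PathConnectedSpace Y] (e : ContinuousMap.HomotopyEquiv X Y) : PathConnectedSpace X := by
  have hx : ∀ x : X, Joined (e.invFun (e.toFun x)) x := fun x ↦ by
    obtain ⟨H⟩ := e.left_inv
    exact ⟨H.evalAt x⟩
  obtain ⟨y₀⟩ := (inferInstance : Nonempty Y)
  refine ⟨⟨e.invFun y₀⟩, fun x x' ↦ ?_⟩
  have h1 : Joined (e.invFun (e.toFun x)) (e.invFun (e.toFun x')) := by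
    obtain ⟨γ⟩ := PathConnectedSpace.joined (e.toFun x) (e.toFun x')
    exact ⟨γ.map e.invFun.continuous⟩
  exact ((hx x).symm.trans h1).trans (hx x')

/-- **Huang–Huang–Wang–Zhu 2026, Main Theorem 1 (`n = 4`, `P ≃ₕ S¹ × S³`): the connected-fibre
clause is free.** If for every `κ > 0` there is `δ > 0` such that every closed smooth 4-manifold
`P ≃ₕ S¹ × S³` with a metric of `diam ≤ 1`, `sec ≥ -κ`, `Ric ≥ -δ g` admits a smooth submersion
onto `S¹` (the hypotheses and the first two conclusions of the named fact, verbatim), then the named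
fact `huangHuangWangZhu2026_fibresOverCircle_four` holds (with the same `δ`): `P` is compact,
and path connected being homotopy equivalent to `S¹ × S³`, so the general theorem
`Literature.Geometry.Manifold.exists_contMDiff_surjective_mfderiv_isConnected_fibre` replaces the
submersion by one with connected fibres. (In the paper, §4 p. 14, connectedness is proved
metrically instead.) [cite: HuangHuangWangZhu2026, Main Theorem 1 (p. 3) and §4 p. 14 (last paragraph)] -/
theorem huangHuangWangZhu2026_fibresOverCircle_four_of_submersion
    (H : ∀ κ : ℝ, 0 < κ → ∃ δ : ℝ, 0 < δ ∧ ∀ (P : Type) [TopologicalSpace P] [T2Space P]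
      [SecondCountableTopology P] [ChartedSpace (EuclideanSpace ℝ (Fin 4)) P] [IsManifold (𝓡 4) ∞ P]
      [CompactSpace P],
      ContinuousMap.HomotopyEquiv P ((Metric.sphere (0 : EuclideanSpace ℝ (Fin 2)) 1) × (Metric.sphere (0 : EuclideanSpace ℝ (Fin 4)) 1)) →
      ∀ (g : Bundle.ContMDiffRiemannianMetric (𝓡 4) ∞ (EuclideanSpace ℝ (Fin 4)) (TangentSpace (𝓡 4) : P → Type _))
      [(Literature.Geometry.Lorentzian.PseudoRiemannianMetric.ofRiemannian g).HasLeviCivita],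
      (open Bundle in letI : Bundle.RiemannianBundle (fun x : P ↦ TangentSpace (𝓡 4) x) :=
      ⟨g.toContinuousRiemannianMetric.toRiemannianMetric⟩; ∀ x y : P, Manifold.riemannianEDist (𝓡 4) x y ≤ 1) →
      (∀ (x : P) (X Y : TangentSpace (𝓡 4) x),
      -κ * (g.inner x X X * g.inner x Y Y - g.inner x X Y ^ 2) ≤
      (Literature.Geometry.Lorentzian.PseudoRiemannianMetric.ofRiemannian g).curvatureForm
      (Literature.Geometry.Lorentzian.PseudoRiemannianMetric.ofRiemannian g).leviCivita x X Y Y X) →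
      (∀ (x : P) (w : TangentSpace (𝓡 4) x),
      -δ * g.inner x w w ≤ (Literature.Geometry.Lorentzian.PseudoRiemannianMetric.ofRiemannian g).ricci x w w) →
      ∃ f : P → (Metric.sphere (0 : EuclideanSpace ℝ (Fin 2)) 1),
      ContMDiff (𝓡 4) (𝓡 1) ∞ f ∧ ∀ x : P, Function.Surjective (mfderiv (𝓡 4) (𝓡 1) f x)) :
    huangHuangWangZhu2026_fibresOverCircle_four := by
  intro κ hκ
  obtain ⟨δ, hδ, hP⟩ := H κ hκ
  refine ⟨δ, hδ, ?_⟩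
  intro P _ _ _ _ _ _ e g _ hdiam hsec hric
  obtain ⟨f, hf, hsub⟩ := hP P e g hdiam hsec hric
  haveI : PathConnectedSpace (Metric.sphere (0 : EuclideanSpace ℝ (Fin 2)) 1) := by
    refine isPathConnected_iff_pathConnectedSpace.mp (isPathConnected_sphere ?_ _ zero_le_one)
    rw [← Module.finrank_eq_rank, finrank_euclideanSpace_fin]
    norm_num
  haveI : PathConnectedSpace (Metric.sphere (0 : EuclideanSpace ℝ (Fin 4)) 1) := by
    refine isPathConnected_iff_pathConnectedSpace.mp (isPathConnected_sphere ?_ _ zero_le_one)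
    rw [← Module.finrank_eq_rank, finrank_euclideanSpace_fin]
    norm_num
  haveI : PathConnectedSpace P := pathConnectedSpace_of_homotopyEquiv e
  obtain ⟨f', hf', hsub', hconn⟩ :=
    Literature.Geometry.Manifold.exists_contMDiff_surjective_mfderiv_isConnected_fibre hf hsub
  exact ⟨f', hf', hsub', hconn⟩

/-- Conversely the named fact trivially implies its version without the connected-fibre clause, so
the two are EQUIVALENT: for the vendored statement the clause "with connected fibres" is
redundant. [cite: HuangHuangWangZhu2026, Main Theorem 1 (p. 3)] -/
theorem huangHuangWangZhu2026_fibresOverCircle_four_iff_submersion :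
    huangHuangWangZhu2026_fibresOverCircle_four ↔
    (∀ κ : ℝ, 0 < κ → ∃ δ : ℝ, 0 < δ ∧ ∀ (P : Type) [TopologicalSpace P] [T2Space P]
      [SecondCountableTopology P] [ChartedSpace (EuclideanSpace ℝ (Fin 4)) P] [IsManifold (𝓡 4) ∞ P]
      [CompactSpace P],
      ContinuousMap.HomotopyEquiv P ((Metric.sphere (0 : EuclideanSpace ℝ (Fin 2)) 1) × (Metric.sphere (0 : EuclideanSpace ℝ (Fin 4)) 1)) →
      ∀ (g : Bundle.ContMDiffRiemannianMetric (𝓡 4) ∞ (EuclideanSpace ℝ (Fin 4)) (TangentSpace (𝓡 4) : P → Type _))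
      [(Literature.Geometry.Lorentzian.PseudoRiemannianMetric.ofRiemannian g).HasLeviCivita],
      (open Bundle in letI : Bundle.RiemannianBundle (fun x : P ↦ TangentSpace (𝓡 4) x) :=
      ⟨g.toContinuousRiemannianMetric.toRiemannianMetric⟩; ∀ x y : P, Manifold.riemannianEDist (𝓡 4) x y ≤ 1) →
      (∀ (x : P) (X Y : TangentSpace (𝓡 4) x),
      -κ * (g.inner x X X * g.inner x Y Y - g.inner x X Y ^ 2) ≤
      (Literature.Geometry.Lorentzian.PseudoRiemannianMetric.ofRiemannian g).curvatureForm
      (Literature.Geometry.Lorentzian.PseudoRiemannianMetric.ofRiemannian g).leviCivita x X Y Y X) →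
      (∀ (x : P) (w : TangentSpace (𝓡 4) x),
      -δ * g.inner x w w ≤ (Literature.Geometry.Lorentzian.PseudoRiemannianMetric.ofRiemannian g).ricci x w w) →
      ∃ f : P → (Metric.sphere (0 : EuclideanSpace ℝ (Fin 2)) 1),
      ContMDiff (𝓡 4) (𝓡 1) ∞ f ∧ ∀ x : P, Function.Surjective (mfderiv (𝓡 4) (𝓡 1) f x)) := by
  refine ⟨fun h κ hκ ↦ ?_, huangHuangWangZhu2026_fibresOverCircle_four_of_submersion⟩
  obtain ⟨δ, hδ, hP⟩ := h κ hκ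
  refine ⟨δ, hδ, ?_⟩
  intro P _ _ _ _ _ _ e g _ hdiam hsec hric
  obtain ⟨f, hf, hsub, -⟩ := hP P e g hdiam hsec hric
  exact ⟨f, hf, hsub⟩

end Literature.Geometry.Riemannian
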